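import Literature.NumberTheory.EllipticCurves.LeadingTermBSZLocalDensityProofs
import Literature.NumberTheory.EllipticCurves.LeadingTermBSZResidueCountProofs
import Mathlib.Analysis.SpecificLimits.Basic
import Mathlib.NumberTheory.Padics.PadicVal.Basic
import HarnessLib

/-!
# Bhargava–Skinner–Zhang, proof of Lemma 18: `μ₅(Σ₅^ns) = 2/25 (1 - 4/(5⁵-1)) (1 - 5⁻¹⁰)⁻¹`

`Proofs` companion of `Literature/NumberTheory/EllipticCurves/LeadingTerm.lean` (bsd.S27,
`Literature.NumberTheory.EllipticCurves.bhargava_skinner_zhang`), continuing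
`LeadingTermBSZLocalDensityProofs.lean` (the one-prime local density formula
`hasHeightDensity_residues`) and `LeadingTermBSZResidueCountProofs.lean` (the disc bijection behind
the residue counts of the proof of Lemma 18). Source: M. Bhargava, C. Skinner, W. Zhang, *A majority
of elliptic curves over `ℚ` satisfy the Birch and Swinnerton-Dyer conjecture*, arXiv:1407.1826
(2014), proof of Lemma 18 (p. 9):

> "`Σ₅^ns` is the set of those `(A,B) ∈ ℤ₅²` with `A ≡ 2 (mod 5)` and `B ≡ ±2 (mod 5)` (so
> `5 ∣ Δ(A,B)`) and `5 ∤ ord₅(Δ(A,B))` (this is the set of `(A,B)` such that `E_{A,B}` has non-split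
> multiplicative reduction at `5` and `5 ∤ ord₅(Δ(A,B))`); … As was explained above, for any
> `A ≡ 2, 3 (mod 5)`, there are `2(5-1)` residue classes modulo `5^{k+2}` (depending on `A` modulo
> `5^{k+2}`) such that: `ord₅Δ(A,B) = k` if and only if `B` belongs to one of these residue classes.
> Hence `μ₅(Σ₅^ns) = (1-5⁻¹⁰)⁻¹ · Σ_{k=1, 5∤k}^∞ 2(5-1)/5^{k+2} = 2/25 (1 - 4/(5⁵-1)) (1-5⁻¹⁰)⁻¹`."

This file PROVES this density, as a height density over the family (`HasHeightDensity`, the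
tree's Wave0 convention; `ord₅ Δ(A,B) = ord₅(4A³ + 27B²)` since `Δ = -16(4A³+27B²)`,
`padicValInt_disc_eq`):

* `BSZSigmaNs.hasHeightDensity_ord_eq` — for `k ≥ 1`, `{A ≡ 2 (mod 5), ord₅(4A³+27B²) = k}` has
  density `40·5^{k+1}/5^{2(k+2)}·(1-5⁻¹⁰)⁻¹ = 2(5-1)/5^{k+2}·(1-5⁻¹⁰)⁻¹` (the printed summand): the
  condition is a residue condition modulo `5^{k+2}` (`exists_unit_residue_iff`), counted by
  `bsz_lemma18_card_residues_eq` with `Z` = the `20` units modulo `25` on each of the `5^{k+1}`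
  classes of `A` (`card_pairs`);
* `BSZSigmaNs.hasHeightDensity_ord_ge` — `{A ≡ 2 (mod 5), ord₅ ≥ K+1}` has density
  `2/5^{K+2}·(1-5⁻¹⁰)⁻¹ → 0` (same count with `Z` = the `5` multiples of `5` modulo `25`);
* `hasHeightDensity_sigma_ns_five` — **`μ₅(Σ₅^ns) = 2/25 (1 - 4/(5⁵-1)) (1 - 5⁻¹⁰)⁻¹`**, by
  squeezing `Σ₅^ns` between `⋃_{k ≤ K+1, 5∤k} {ord₅ = k}` and its union with `{ord₅ ≥ K+2}`
  (`hasHeightDensity_of_squeeze`, `HasHeightDensity.finset_biSup`) and summing the geometric series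
  `Σ_{k ≥ 1, 5 ∤ k} 5^{-k} = 1/4 - 1/(5⁵-1)` (`hasSum_fifth_powers_not_mult_five`).

That `Σ₅^ns` consists of the family members with non-split multiplicative reduction at `5` (and
`5 ∤ ord₅Δ`) is `hasMultiplicative_not_split_five_shortWeierstrass_iff` of
`LeadingTermBSZSplitReductionProofs`; the companion leading-order class densities (`Σ₅^g`, the
multiplicative classes, `(3,±1)`, `(2,±2)`) are in `LeadingTermBSZLocalDensityProofs`. The third piece
`Σ₅^spl` of `S₁'(5)` involves the `𝓛`-invariant and is not treated (its residue COUNT is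
`bsz_lemma18_card_residues_eq`, which corrects the printed `(2p-1)(p-1)` to `2(p-1)²`; see the caveat
in the docstring of `bhargava_skinner_zhang`). Generic lemmas proved on the way:
`heightProportion_mono_of_isInHeightFamily`, `heightProportion_or_of_disjoint`, `HasHeightDensity.or_of_disjoint`,
`HasHeightDensity.finset_biSup`, `hasHeightDensity_of_squeeze`.

No definitions and no named facts are introduced (D-0026).

## References

* M. Bhargava, C. Skinner, W. Zhang, arXiv:1407.1826 (2014), proof of Lemma 18 (p. 9), the set
  `Σ₅^ns` and its measure. [cite: BhargavaSkinnerZhang2014, Lemma 18 (proof)]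
-/



noncomputable section

open Filter Topology

open scoped Classical

namespace Literature.NumberTheory.EllipticCurves

/-! ### Generic lemmas on height proportions and height densities -/

/-- Monotonicity of proportions in the predicate, where the implication is only required on members of
the family (companion of the tree's `heightProportion_mono`). [folklore] -/
theorem heightProportion_mono_of_isInHeightFamily {P Q : ℤ × ℤ → Prop}
    (h : ∀ AB, IsInHeightFamily AB → P AB → Q AB) (X : ℕ) :
    heightProportion P X ≤ heightProportion Q X := by
  rw [heightProportion_eq_card_div, heightProportion_eq_card_div]
  refine div_le_div_of_nonneg_right ?_ (Nat.cast_nonneg _)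
  exact_mod_cast Finset.card_le_card fun AB hAB ↦ by
    rw [Finset.mem_filter] at hAB ⊢
    exact ⟨hAB.1, h AB ((mem_heightFamilyBelow_iff AB X).mp hAB.1).1 hAB.2⟩

/-- Additivity of proportions over two predicates that are disjoint on the family. [folklore] -/
theorem heightProportion_or_of_disjoint {P Q : ℤ × ℤ → Prop}
    (h : ∀ AB, IsInHeightFamily AB → P AB → ¬ Q AB) (X : ℕ) :
    heightProportion (fun AB ↦ P AB ∨ Q AB) X = heightProportion P X + heightProportion Q X := by
  rw [heightProportion_eq_card_div, heightProportion_eq_card_div, heightProportion_eq_card_div,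
    ← add_div]
  congr 1
  rw [← Nat.cast_add, ← Finset.card_union_of_disjoint]
  · rw [Finset.filter_or]
  · rw [Finset.disjoint_filter]
    exact fun AB hAB hP hQ ↦ h AB ((mem_heightFamilyBelow_iff AB X).mp hAB).1 hP hQ

/-- The empty predicate has proportion `0`. [folklore] -/
theorem heightProportion_false (X : ℕ) : heightProportion (fun _ : ℤ × ℤ ↦ False) X = 0 := by
  rw [heightProportion_eq_card_div]
  simp

/-- Densities add over two predicates that are disjoint on the family. [folklore] -/
theorem HasHeightDensity.or_of_disjoint {P Q : ℤ × ℤ → Prop} {a b : ℝ} (hP : HasHeightDensity P a)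
    (hQ : HasHeightDensity Q b) (h : ∀ AB, IsInHeightFamily AB → P AB → ¬ Q AB) :
    HasHeightDensity (fun AB ↦ P AB ∨ Q AB) (a + b) := by
  unfold HasHeightDensity at *
  have : heightProportion (fun AB ↦ P AB ∨ Q AB) =
      fun X ↦ heightProportion P X + heightProportion Q X :=
    funext (heightProportion_or_of_disjoint h)
  rw [this]
  exact hP.add hQ

/-- Densities add over a finite family of predicates that are pairwise disjoint on the family.
[folklore] -/
theorem HasHeightDensity.finset_biSup {ι : Type*} (s : Finset ι) (P : ι → ℤ × ℤ → Prop) (δ : ι → ℝ)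
    (hP : ∀ i ∈ s, HasHeightDensity (P i) (δ i))
    (hdisj : ∀ i ∈ s, ∀ j ∈ s, i ≠ j → ∀ AB, IsInHeightFamily AB → P i AB → ¬ P j AB) :
    HasHeightDensity (fun AB ↦ ∃ i ∈ s, P i AB) (∑ i ∈ s, δ i) := by
  induction s using Finset.induction_on with
  | empty =>
    have : (fun AB : ℤ × ℤ ↦ ∃ i ∈ (∅ : Finset ι), P i AB) = fun _ ↦ False := by
      ext AB; simp
    rw [this, Finset.sum_empty]
    unfold HasHeightDensity
    rw [show heightProportion (fun _ : ℤ × ℤ ↦ False) = fun _ ↦ (0 : ℝ) from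
      funext heightProportion_false]
    exact tendsto_const_nhds
  | insert a s ha ih =>
    have hfun : (fun AB : ℤ × ℤ ↦ ∃ i ∈ insert a s, P i AB) =
        fun AB ↦ P a AB ∨ ∃ i ∈ s, P i AB := by
      ext AB
      simp [Finset.mem_insert, or_and_right, exists_or]
    rw [hfun, Finset.sum_insert ha]
    refine (hP a (Finset.mem_insert_self _ _)).or_of_disjoint
      (ih (fun i hi ↦ hP i (Finset.mem_insert_of_mem hi))
        (fun i hi j hj ↦ hdisj i (Finset.mem_insert_of_mem hi) j (Finset.mem_insert_of_mem hj)))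
      ?_
    rintro AB hAB hPa ⟨j, hj, hPj⟩
    exact hdisj a (Finset.mem_insert_self _ _) j (Finset.mem_insert_of_mem hj)
      (fun h ↦ ha (h ▸ hj)) AB hAB hPa hPj

/-- **Squeeze for height densities**: if `L_K ⊆ P ⊆ U_K` on the family for every `K`, with
`μ(L_K) = ℓ_K → μ` and `μ(U_K) = u_K → μ`, then `P` has height density `μ`. [folklore] -/
theorem hasHeightDensity_of_squeeze {P : ℤ × ℤ → Prop} {μ : ℝ} (L U : ℕ → ℤ × ℤ → Prop)
    (ℓ u : ℕ → ℝ) (hL : ∀ K, HasHeightDensity (L K) (ℓ K)) (hU : ∀ K, HasHeightDensity (U K) (u K))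
    (hLP : ∀ K AB, IsInHeightFamily AB → L K AB → P AB)
    (hPU : ∀ K AB, IsInHeightFamily AB → P AB → U K AB)
    (hℓ : Tendsto ℓ atTop (𝓝 μ)) (hu : Tendsto u atTop (𝓝 μ)) : HasHeightDensity P μ := by
  unfold HasHeightDensity at *
  rw [Metric.tendsto_atTop]
  intro ε hε
  obtain ⟨K₁, hK₁⟩ := (Metric.tendsto_atTop.mp hℓ) (ε / 2) (by linarith)
  obtain ⟨K₂, hK₂⟩ := (Metric.tendsto_atTop.mp hu) (ε / 2) (by linarith)
  set K := max K₁ K₂ with hK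
  have h1 : dist (ℓ K) μ < ε / 2 := hK₁ K (le_max_left _ _)
  have h2 : dist (u K) μ < ε / 2 := hK₂ K (le_max_right _ _)
  obtain ⟨N₁, hN₁⟩ := (Metric.tendsto_atTop.mp (hL K)) (ε / 2) (by linarith)
  obtain ⟨N₂, hN₂⟩ := (Metric.tendsto_atTop.mp (hU K)) (ε / 2) (by linarith)
  refine ⟨max N₁ N₂, fun n hn ↦ ?_⟩
  have a := hN₁ n (le_trans (le_max_left _ _) hn)
  have b := hN₂ n (le_trans (le_max_right _ _) hn)
  have m1 := heightProportion_mono_of_isInHeightFamily (hLP K) n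
  have m2 := heightProportion_mono_of_isInHeightFamily (hPU K) n
  rw [Real.dist_eq, abs_lt] at a b h1 h2 ⊢
  constructor <;> linarith [a.1, a.2, b.1, b.2, h1.1, h1.2, h2.1, h2.2]

end Literature.NumberTheory.EllipticCurves

namespace Literature.NumberTheory.EllipticCurves

/-! ### The series `Σ_{k ≥ 1, 5 ∤ k} 5^{-k} = 1/4 - 1/(5⁵ - 1)` -/

/-- The geometric series without its constant term: `Σ_{k ≥ 1} r^k = 1/(1-r) - 1`. [folklore] -/
theorem hasSum_geometric_from_one {r : ℝ} (h0 : 0 ≤ r) (h1 : r < 1) :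
    HasSum (fun k : ℕ ↦ if 1 ≤ k then r ^ k else 0) (1 / (1 - r) - 1) := by
  have hg := hasSum_geometric_of_lt_one h0 h1
  have h0' : HasSum (fun k : ℕ ↦ if k = 0 then (1 : ℝ) else 0) 1 := hasSum_ite_eq 0 1
  have hfun : (fun k : ℕ ↦ if 1 ≤ k then r ^ k else 0) =
      fun k ↦ r ^ k - (if k = 0 then (1 : ℝ) else 0) := by
    funext k
    by_cases hk : k = 0
    · subst hk; simp
    · simp [hk, Nat.one_le_iff_ne_zero.mpr hk]
  rw [hfun, one_div]
  exact hg.sub h0'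

/-- `Σ_{k ≥ 1, 5 ∣ k} 5^{-k} = 1/(5⁵ - 1)`. [folklore] -/
theorem hasSum_fifth_powers_mult_five :
    HasSum (fun k : ℕ ↦ if 1 ≤ k ∧ 5 ∣ k then (1 / 5 : ℝ) ^ k else 0) (1 / (5 ^ 5 - 1)) := by
  have hinj : Function.Injective (fun j : ℕ ↦ 5 * j) := fun a b h ↦ by simpa using h
  have hsupp : ∀ k ∉ Set.range (fun j : ℕ ↦ 5 * j),
      (fun k : ℕ ↦ if 1 ≤ k ∧ 5 ∣ k then (1 / 5 : ℝ) ^ k else 0) k = 0 := by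
    intro k hk
    simp only [Set.mem_range, not_exists] at hk
    have : ¬ (5 ∣ k) := fun ⟨j, hj⟩ ↦ hk j hj.symm
    simp [this]
  rw [← hinj.hasSum_iff hsupp]
  have hr0 : (0 : ℝ) ≤ (1 / 5) ^ 5 := by positivity
  have hr1 : ((1 / 5 : ℝ)) ^ 5 < 1 := by norm_num
  have h := hasSum_geometric_from_one hr0 hr1
  have hfun : ((fun k : ℕ ↦ if 1 ≤ k ∧ 5 ∣ k then (1 / 5 : ℝ) ^ k else 0) ∘ fun j : ℕ ↦ 5 * j) =
      fun j ↦ if 1 ≤ j then ((1 / 5 : ℝ) ^ 5) ^ j else 0 := by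
    funext j
    simp only [Function.comp_apply]
    by_cases hj : 1 ≤ j
    · have : 1 ≤ 5 * j ∧ 5 ∣ 5 * j := ⟨by omega, dvd_mul_right 5 j⟩
      rw [if_pos this, if_pos hj, ← pow_mul]
    · have hj0 : j = 0 := by omega
      subst hj0; simp
  have hval : (1 / (5 ^ 5 - 1) : ℝ) = 1 / (1 - (1 / 5) ^ 5) - 1 := by norm_num
  rw [hfun, hval]
  exact h

/-- `Σ_{k ≥ 1, 5 ∤ k} 5^{-k} = 1/4 - 1/(5⁵ - 1)`. [folklore] -/
theorem hasSum_fifth_powers_not_mult_five :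
    HasSum (fun k : ℕ ↦ if 1 ≤ k ∧ ¬ 5 ∣ k then (1 / 5 : ℝ) ^ k else 0) (1 / 4 - 1 / (5 ^ 5 - 1)) := by
  have h1 := hasSum_geometric_from_one (r := (1 / 5 : ℝ)) (by norm_num) (by norm_num)
  have h2 := hasSum_fifth_powers_mult_five
  have hfun : (fun k : ℕ ↦ if 1 ≤ k ∧ ¬ 5 ∣ k then (1 / 5 : ℝ) ^ k else 0) =
      fun k ↦ (if 1 ≤ k then (1 / 5 : ℝ) ^ k else 0) - (if 1 ≤ k ∧ 5 ∣ k then (1 / 5 : ℝ) ^ k else 0) := by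
    funext k
    by_cases hk : 1 ≤ k
    · by_cases h5 : 5 ∣ k
      · simp [hk, h5]
      · simp [hk, h5]
    · simp [hk]
  have hval : (1 / 4 - 1 / (5 ^ 5 - 1) : ℝ) = (1 / (1 - 1 / 5) - 1) - 1 / (5 ^ 5 - 1) := by norm_num
  rw [hfun, hval]
  exact h1.sub h2

/-- Partial sums of `Σ_{k ≥ 1, 5 ∤ k} c·5^{-k}` over `k ≤ K` converge to `c (1/4 - 1/(5⁵-1))`. [folklore] -/
theorem tendsto_partial_sums_not_mult_five (c : ℝ) :
    Tendsto (fun K : ℕ ↦ ∑ k ∈ (Finset.range (K + 1)).filter (fun k ↦ 1 ≤ k ∧ ¬ 5 ∣ k),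
      c * (1 / 5 : ℝ) ^ k) atTop (𝓝 (c * (1 / 4 - 1 / (5 ^ 5 - 1)))) := by
  have h := (hasSum_fifth_powers_not_mult_five.mul_left c).tendsto_sum_nat
  have h' := h.comp (tendsto_add_atTop_nat 1)
  refine h'.congr fun K ↦ ?_
  simp only [Function.comp_apply]
  rw [Finset.sum_filter]
  refine Finset.sum_congr rfl fun k _ ↦ ?_
  split_ifs <;> simp

end Literature.NumberTheory.EllipticCurves

namespace Literature.NumberTheory.EllipticCurves

namespace BSZSigmaNs

/-! ### Residues modulo `5` -/

/-- For `a ≡ 2 (mod 5)`: `4a³ + 27b² ≡ 0 ↔ b ≡ ±2`. [folklore] -/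
theorem zmod5_disc_two : ∀ b : ZMod 5, 4 * (2 : ZMod 5) ^ 3 + 27 * b ^ 2 = 0 ↔ (b = 2 ∨ b = 3) := by
  decide

/-! ### `ord₅ = k` and `ord₅ ≥ K + 1` as residue conditions -/

/-- Reduction `ZMod 25 → ZMod 5`. [folklore] -/
theorem five_dvd_twentyfive : 5 ∣ 5 ^ 2 := dvd_pow_self 5 two_ne_zero

/-- The reduction of `z (mod 25)` modulo `5` vanishes iff `5 ∣ z.val`. [folklore] -/
theorem castHom_eq_zero_iff_dvd_val (z : ZMod (5 ^ 2)) :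
    ZMod.castHom five_dvd_twentyfive (ZMod 5) z = 0 ↔ 5 ∣ z.val := by
  rw [← ZMod.natCast_zmod_val z, map_natCast, ZMod.natCast_eq_zero_iff, ZMod.natCast_zmod_val]

/-- **`ord₅ D = k` as a residue condition modulo `5^{k+2}`** (`k ≥ 1`): `D ≡ 5^k z (mod 5^{k+2})`
for some `z (mod 25)` with `z ≢ 0 (mod 5)` iff `5^k ∣ D` and `5^{k+1} ∤ D`. [folklore] -/
theorem exists_unit_residue_iff {k : ℕ} (D : ℤ) :
    (∃ z : ZMod (5 ^ 2), ZMod.castHom five_dvd_twentyfive (ZMod 5) z ≠ 0 ∧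
        (D : ZMod (5 ^ (k + 2))) = (5 : ZMod (5 ^ (k + 2))) ^ k * (z.val : ZMod (5 ^ (k + 2)))) ↔
      (5 : ℤ) ^ k ∣ D ∧ ¬ (5 : ℤ) ^ (k + 1) ∣ D := by
  constructor
  · rintro ⟨z, hz, hD⟩
    have hD' : (D : ZMod (5 ^ (k + 2))) = ((5 ^ k * z.val : ℕ) : ℤ) := by
      rw [hD]; push_cast; ring
    rw [ZMod.intCast_eq_intCast_iff] at hD'
    have hmod := (Int.ModEq.dvd hD'.symm)
    -- `D - 5^k z.val = 5^{k+2} t`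
    push_cast at hmod
    obtain ⟨t, ht⟩ := hmod
    have hDeq : D = 5 ^ k * (z.val : ℤ) + 5 ^ (k + 2) * t := by linear_combination ht
    refine ⟨⟨(z.val : ℤ) + 25 * t, by rw [hDeq]; ring⟩, fun ⟨w, hw⟩ ↦ hz ?_⟩
    rw [castHom_eq_zero_iff_dvd_val]
    have h5 : (5 : ℤ) ∣ (z.val : ℤ) := by
      have : (5 : ℤ) ^ (k + 1) ∣ 5 ^ k * ((z.val : ℤ) + 25 * t) := by
        rw [show (5 : ℤ) ^ k * ((z.val : ℤ) + 25 * t) = D by rw [hDeq]; ring]; exact ⟨w, hw⟩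
      rw [pow_succ] at this
      have h' := (mul_dvd_mul_iff_left (pow_ne_zero k (by norm_num : (5 : ℤ) ≠ 0))).mp this
      have : (5 : ℤ) ∣ 25 * t := ⟨5 * t, by ring⟩
      exact (dvd_add_right this).mp (by simpa [add_comm] using h')
    exact_mod_cast h5
  · rintro ⟨⟨u, hu⟩, hnot⟩
    refine ⟨(u : ZMod (5 ^ 2)), ?_, ?_⟩
    · rw [map_intCast, ne_eq, ZMod.intCast_zmod_eq_zero_iff_dvd]
      rintro ⟨w, hw⟩
      exact hnot ⟨w, by rw [hu, hw]; ring⟩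
    · have hval : ((u : ZMod (5 ^ 2)).val : ℤ) ≡ u [ZMOD (5 ^ 2 : ℕ)] := by
        rw [ZMod.val_intCast]
        exact Int.mod_modEq u _
      have hmul : (5 : ℤ) ^ k * ((u : ZMod (5 ^ 2)).val : ℤ) ≡ 5 ^ k * u [ZMOD (5 ^ (k + 2) : ℕ)] := by
        have h := Int.ModEq.mul_left' (c := (5 : ℤ) ^ k) hval
        have hn : ((5 ^ (k + 2) : ℕ) : ℤ) = (5 : ℤ) ^ k * ((5 ^ 2 : ℕ) : ℤ) := by push_cast; ring
        rwa [hn]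
      have : ((5 ^ k * u : ℤ) : ZMod (5 ^ (k + 2))) =
          (((5 : ℤ) ^ k * ((u : ZMod (5 ^ 2)).val : ℤ) : ℤ) : ZMod (5 ^ (k + 2))) :=
        (ZMod.intCast_eq_intCast_iff _ _ _).mpr hmul.symm
      rw [hu, this]
      push_cast
      ring

/-- **`ord₅ D ≥ K + 1` as a residue condition modulo `5^{K+2}`**: `D ≡ 5^K z (mod 5^{K+2})` for
some `z (mod 25)` with `z ≡ 0 (mod 5)` iff `5^{K+1} ∣ D`. [folklore] -/
theorem exists_zero_residue_iff {K : ℕ} (D : ℤ) :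
    (∃ z : ZMod (5 ^ 2), ZMod.castHom five_dvd_twentyfive (ZMod 5) z = 0 ∧
        (D : ZMod (5 ^ (K + 2))) = (5 : ZMod (5 ^ (K + 2))) ^ K * (z.val : ZMod (5 ^ (K + 2)))) ↔
      (5 : ℤ) ^ (K + 1) ∣ D := by
  constructor
  · rintro ⟨z, hz, hD⟩
    rw [castHom_eq_zero_iff_dvd_val] at hz
    obtain ⟨w, hw⟩ := hz
    have hD' : (D : ZMod (5 ^ (K + 2))) = ((5 ^ (K + 1) * w : ℕ) : ℤ) := by
      rw [hD, hw]; push_cast; ring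
    rw [ZMod.intCast_eq_intCast_iff] at hD'
    obtain ⟨t, ht⟩ := Int.ModEq.dvd hD'.symm
    push_cast at ht
    exact ⟨(w : ℤ) + 5 * t, by linear_combination ht⟩
  · rintro ⟨w, hw⟩
    refine ⟨((5 * w : ℤ) : ZMod (5 ^ 2)), ?_, ?_⟩
    · rw [map_intCast, ZMod.intCast_zmod_eq_zero_iff_dvd]
      exact ⟨w, by push_cast; ring⟩
    · have hval : ((((5 * w : ℤ)) : ZMod (5 ^ 2)).val : ℤ) ≡ 5 * w [ZMOD (5 ^ 2 : ℕ)] := by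
        rw [ZMod.val_intCast]
        exact Int.mod_modEq _ _
      have hmul : (5 : ℤ) ^ K * ((((5 * w : ℤ)) : ZMod (5 ^ 2)).val : ℤ) ≡ 5 ^ K * (5 * w)
          [ZMOD (5 ^ (K + 2) : ℕ)] := by
        have h := Int.ModEq.mul_left' (c := (5 : ℤ) ^ K) hval
        have hn : ((5 ^ (K + 2) : ℕ) : ℤ) = (5 : ℤ) ^ K * ((5 ^ 2 : ℕ) : ℤ) := by push_cast; ring
        rwa [hn]
      have : ((5 ^ K * (5 * w) : ℤ) : ZMod (5 ^ (K + 2))) =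
          (((5 : ℤ) ^ K * ((((5 * w : ℤ)) : ZMod (5 ^ 2)).val : ℤ) : ℤ) : ZMod (5 ^ (K + 2))) :=
        (ZMod.intCast_eq_intCast_iff _ _ _).mpr hmul.symm
      rw [hw, show (5 : ℤ) ^ (K + 1) * w = 5 ^ K * (5 * w) by ring, this]
      push_cast
      ring

end BSZSigmaNs

end Literature.NumberTheory.EllipticCurves


namespace Literature.NumberTheory.EllipticCurves

namespace BSZSigmaNs

/-! ### The residue sets modulo `5^{k+2}` and their cardinalities -/

/-- `5 ∣ 5^{k+2}` (the reduction `ZMod 5^{k+2} → ZMod 5`, with the proof term of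
`bsz_lemma18_card_residues_eq`). [folklore] -/
theorem five_dvd_pow (k : ℕ) : 5 ∣ 5 ^ (k + 2) := dvd_pow_self 5 (Nat.succ_ne_zero (k + 1))

/-- The units modulo `25` (as residues with nonzero reduction mod `5`) number `20`. [folklore] -/
theorem card_units_mod_twentyfive :
    ((Finset.univ : Finset (ZMod (5 ^ 2))).filter
      (fun z ↦ ZMod.castHom five_dvd_twentyfive (ZMod 5) z ≠ 0)).card = 20 := by
  decide

/-- The multiples of `5` modulo `25` number `5`. [folklore] -/
theorem card_nonunits_mod_twentyfive :
    ((Finset.univ : Finset (ZMod (5 ^ 2))).filter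
      (fun z ↦ ZMod.castHom five_dvd_twentyfive (ZMod 5) z = 0)).card = 5 := by
  decide

/-- Each fibre of `ZMod 5^{k+2} → ZMod 5` has `5^{k+1}` elements. [folklore] -/
theorem card_fibre (k : ℕ) (b : ZMod 5) :
    ((Finset.univ : Finset (ZMod (5 ^ (k + 2)))).filter
      (fun a ↦ ZMod.castHom (five_dvd_pow k) (ZMod 5) a = b)).card = 5 ^ (k + 1) := by
  haveI : Fact (Nat.Prime 5) := ⟨Nat.prime_five⟩
  haveI : NeZero (5 ^ (k + 2)) := ⟨pow_ne_zero _ (by norm_num)⟩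
  set c := ((Finset.univ : Finset (ZMod (5 ^ (k + 2)))).filter
      (fun a ↦ ZMod.castHom (five_dvd_pow k) (ZMod 5) a = 0)).card with hc
  have hall : ∀ b' : ZMod 5, ((Finset.univ : Finset (ZMod (5 ^ (k + 2)))).filter
      (fun a ↦ ZMod.castHom (five_dvd_pow k) (ZMod 5) a = b')).card = c :=
    fun b' ↦ BSZLemma18.card_filter_castHom_eq (five_dvd_pow k) b'
  have hsum := Finset.card_eq_sum_card_fiberwise (s := (Finset.univ : Finset (ZMod (5 ^ (k + 2)))))
    (t := (Finset.univ : Finset (ZMod 5))) (f := fun a ↦ ZMod.castHom (five_dvd_pow k) (ZMod 5) a)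
    (fun _ _ ↦ Finset.mem_univ _)
  simp only [hall, Finset.sum_const, Finset.card_univ, ZMod.card, smul_eq_mul] at hsum
  rw [hall]
  have h5 : (5 : ℕ) ^ (k + 2) = 5 * 5 ^ (k + 1) := by ring
  rw [h5] at hsum
  omega

/-- For `a ≡ 2 (mod 5)`: `a ≢ 0` and `27b² ≡ -4a³` is solvable (`b₀ = 2`) — the hypotheses of
`bsz_lemma18_card_residues_eq`. [folklore] -/
theorem hyp_of_castHom_eq_two {k : ℕ} {a : ZMod (5 ^ (k + 2))}
    (ha : ZMod.castHom (five_dvd_pow k) (ZMod 5) a = 2) :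
    ZMod.castHom (five_dvd_pow k) (ZMod 5) a ≠ 0 ∧
      ∃ b₀ : ZMod 5, 4 * (ZMod.castHom (five_dvd_pow k) (ZMod 5) a) ^ 3 + 27 * b₀ ^ 2 = 0 := by
  rw [ha]
  exact ⟨by decide, ⟨2, by decide⟩⟩

/-- **Cardinality of the residue sets.** For `k ≥ 1` and any set `Z` of residues modulo `25`, the
pairs `(a, b) (mod 5^{k+2})` with `a ≡ 2 (mod 5)` and `4a³ + 27b² ≡ 5^k z` for some `z ∈ Z` number
`5^{k+1} · 2#Z` (`bsz_lemma18_card_residues_eq` on each of the `5^{k+1}` classes `a`). [folklore] -/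
theorem card_pairs (k : ℕ) (hk : 1 ≤ k) (Z : Finset (ZMod (5 ^ 2))) :
    ((Finset.univ : Finset (ZMod (5 ^ (k + 2)) × ZMod (5 ^ (k + 2)))).filter
      (fun r ↦ ZMod.castHom (five_dvd_pow k) (ZMod 5) r.1 = 2 ∧ ∃ z ∈ Z,
        4 * r.1 ^ 3 + 27 * r.2 ^ 2 =
          (5 : ZMod (5 ^ (k + 2))) ^ k * (z.val : ZMod (5 ^ (k + 2))))).card =
      5 ^ (k + 1) * (2 * Z.card) := by
  haveI : Fact (Nat.Prime 5) := ⟨Nat.prime_five⟩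
  haveI : NeZero (5 ^ (k + 2)) := ⟨pow_ne_zero _ (by norm_num)⟩
  set red := ZMod.castHom (five_dvd_pow k) (ZMod 5) with hred
  have hcount : ∀ a : ZMod (5 ^ (k + 2)), red a = 2 →
      ((Finset.univ : Finset (ZMod (5 ^ (k + 2)))).filter (fun b ↦ ∃ z ∈ Z,
        4 * a ^ 3 + 27 * b ^ 2 =
          (5 : ZMod (5 ^ (k + 2))) ^ k * (z.val : ZMod (5 ^ (k + 2))))).card = 2 * Z.card := by
    intro a ha
    obtain ⟨hA, hsol⟩ := hyp_of_castHom_eq_two ha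
    have h := bsz_lemma18_card_residues_eq (p := 5) le_rfl hk a hA hsol Z
    simpa using h
  rw [Finset.card_filter, ← Finset.univ_product_univ, Finset.sum_product]
  have hinner : ∀ a : ZMod (5 ^ (k + 2)),
      (∑ b : ZMod (5 ^ (k + 2)), if red (a, b).1 = 2 ∧ ∃ z ∈ Z,
          4 * (a, b).1 ^ 3 + 27 * (a, b).2 ^ 2 =
            (5 : ZMod (5 ^ (k + 2))) ^ k * (z.val : ZMod (5 ^ (k + 2))) then 1 else 0) =
        if red a = 2 then 2 * Z.card else 0 := by
    intro a
    by_cases ha : red a = 2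
    · rw [if_pos ha, ← hcount a ha, Finset.card_filter]
      exact Finset.sum_congr rfl fun b _ ↦ by simp [ha]
    · rw [if_neg ha]
      exact Finset.sum_eq_zero fun b _ ↦ by simp [ha]
  rw [Finset.sum_congr rfl fun a _ ↦ hinner a, Finset.sum_ite, Finset.sum_const_zero, add_zero,
    Finset.sum_const, smul_eq_mul, card_fibre k 2]

/-! ### The densities of `{A ≡ 2 (5), ord₅(4A³+27B²) = k}` and `{A ≡ 2 (5), ord₅ ≥ K+1}` -/

/-- The reduction of the class of an integer modulo `5^{k+2}` is its class modulo `5`. [folklore] -/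
theorem castHom_intCast (k : ℕ) (A : ℤ) :
    ZMod.castHom (five_dvd_pow k) (ZMod 5) (A : ZMod (5 ^ (k + 2))) = (A : ZMod 5) :=
  map_intCast _ A

/-- **Density of `{A ≡ 2 (mod 5), ord₅(4A³ + 27B²) = k}`** (`k ≥ 1`):
`40·5^{k+1}/5^{2(k+2)} · (1 - 5⁻¹⁰)⁻¹ = 8/5^{k+2} · (1 - 5⁻¹⁰)⁻¹` — the summand
"`2(5-1)/5^{k+2}`" of the printed `μ₅(Σ₅^ns)` (two discs of `B`, `4·5` unit values of
`(4A³+27B²)/5^k (mod 25)` each … per class of `A`). [cite: BhargavaSkinnerZhang2014, Lemma 18 (proof)] -/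
theorem hasHeightDensity_ord_eq {k : ℕ} (hk : 1 ≤ k) :
    HasHeightDensity (fun AB : ℤ × ℤ ↦ (AB.1 : ZMod 5) = 2 ∧
        (5 : ℤ) ^ k ∣ 4 * AB.1 ^ 3 + 27 * AB.2 ^ 2 ∧ ¬ (5 : ℤ) ^ (k + 1) ∣ 4 * AB.1 ^ 3 + 27 * AB.2 ^ 2)
      (((5 ^ (k + 1) * (2 * 20) : ℕ) : ℝ) / ((5 : ℝ) ^ (k + 2)) ^ 2 / (1 - 1 / (5 : ℝ) ^ 10)) := by
  set Zu : Finset (ZMod (5 ^ 2)) := (Finset.univ : Finset (ZMod (5 ^ 2))).filter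
      (fun z ↦ ZMod.castHom five_dvd_twentyfive (ZMod 5) z ≠ 0) with hZu
  set R : Finset (ZMod (5 ^ (k + 2)) × ZMod (5 ^ (k + 2))) :=
    (Finset.univ : Finset (ZMod (5 ^ (k + 2)) × ZMod (5 ^ (k + 2)))).filter
      (fun r ↦ ZMod.castHom (five_dvd_pow k) (ZMod 5) r.1 = 2 ∧ ∃ z ∈ Zu,
        4 * r.1 ^ 3 + 27 * r.2 ^ 2 =
          (5 : ZMod (5 ^ (k + 2))) ^ k * (z.val : ZMod (5 ^ (k + 2)))) with hRdef
  have hmem : ∀ AB : ℤ × ℤ,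
      (((AB.1 : ZMod (5 ^ (k + 2))), (AB.2 : ZMod (5 ^ (k + 2)))) ∈ R) ↔
        ((AB.1 : ZMod 5) = 2 ∧ (5 : ℤ) ^ k ∣ 4 * AB.1 ^ 3 + 27 * AB.2 ^ 2 ∧
          ¬ (5 : ℤ) ^ (k + 1) ∣ 4 * AB.1 ^ 3 + 27 * AB.2 ^ 2) := by
    intro AB
    rw [hRdef, Finset.mem_filter, castHom_intCast]
    simp only [Finset.mem_univ, true_and, hZu, Finset.mem_filter]
    rw [show (4 * (AB.1 : ZMod (5 ^ (k + 2))) ^ 3 + 27 * (AB.2 : ZMod (5 ^ (k + 2))) ^ 2) =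
        ((4 * AB.1 ^ 3 + 27 * AB.2 ^ 2 : ℤ) : ZMod (5 ^ (k + 2))) by push_cast; ring]
    rw [show (∃ z, (ZMod.castHom five_dvd_twentyfive (ZMod 5)) z ≠ 0 ∧
        ((4 * AB.1 ^ 3 + 27 * AB.2 ^ 2 : ℤ) : ZMod (5 ^ (k + 2))) =
          (5 : ZMod (5 ^ (k + 2))) ^ k * (z.val : ZMod (5 ^ (k + 2)))) ↔ _ from
      exists_unit_residue_iff (4 * AB.1 ^ 3 + 27 * AB.2 ^ 2)]
  have hR : ∀ AB : ℤ × ℤ, ((AB.1 : ZMod (5 ^ (k + 2))), (AB.2 : ZMod (5 ^ (k + 2)))) ∈ R →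
      ¬ ((5 : ℕ) : ℤ) ∣ AB.1 := by
    intro AB h h5
    have h2 := ((hmem AB).mp h).1
    have h0 := (ZMod.intCast_zmod_eq_zero_iff_dvd AB.1 5).mpr h5
    rw [h0] at h2
    exact absurd h2 (by decide)
  have hcard : R.card = 5 ^ (k + 1) * (2 * 20) := by
    rw [hRdef, card_pairs k hk Zu, hZu, card_units_mod_twentyfive]
  have h := hasHeightDensity_residues (by norm_num : (5 : ℕ).Prime) (k + 2) R hR
  have hfun : (fun AB : ℤ × ℤ ↦ ((AB.1 : ZMod (5 ^ (k + 2))), (AB.2 : ZMod (5 ^ (k + 2)))) ∈ R) =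
      (fun AB : ℤ × ℤ ↦ (AB.1 : ZMod 5) = 2 ∧ (5 : ℤ) ^ k ∣ 4 * AB.1 ^ 3 + 27 * AB.2 ^ 2 ∧
        ¬ (5 : ℤ) ^ (k + 1) ∣ 4 * AB.1 ^ 3 + 27 * AB.2 ^ 2) :=
    funext fun AB ↦ propext (hmem AB)
  rw [hfun, hcard] at h
  push_cast at h ⊢
  exact h

/-- **Density of `{A ≡ 2 (mod 5), ord₅(4A³ + 27B²) ≥ K + 1}`** (`K ≥ 1`):
`10·5^{K+1}/5^{2(K+2)} · (1 - 5⁻¹⁰)⁻¹ = 2/5^{K+2} · (1 - 5⁻¹⁰)⁻¹ → 0` (the tail that the printed sum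
over `k` discards in the limit). [folklore] -/
theorem hasHeightDensity_ord_ge {K : ℕ} (hK : 1 ≤ K) :
    HasHeightDensity (fun AB : ℤ × ℤ ↦ (AB.1 : ZMod 5) = 2 ∧
        (5 : ℤ) ^ (K + 1) ∣ 4 * AB.1 ^ 3 + 27 * AB.2 ^ 2)
      (((5 ^ (K + 1) * (2 * 5) : ℕ) : ℝ) / ((5 : ℝ) ^ (K + 2)) ^ 2 / (1 - 1 / (5 : ℝ) ^ 10)) := by
  set Z0 : Finset (ZMod (5 ^ 2)) := (Finset.univ : Finset (ZMod (5 ^ 2))).filter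
      (fun z ↦ ZMod.castHom five_dvd_twentyfive (ZMod 5) z = 0) with hZ0
  set R : Finset (ZMod (5 ^ (K + 2)) × ZMod (5 ^ (K + 2))) :=
    (Finset.univ : Finset (ZMod (5 ^ (K + 2)) × ZMod (5 ^ (K + 2)))).filter
      (fun r ↦ ZMod.castHom (five_dvd_pow K) (ZMod 5) r.1 = 2 ∧ ∃ z ∈ Z0,
        4 * r.1 ^ 3 + 27 * r.2 ^ 2 =
          (5 : ZMod (5 ^ (K + 2))) ^ K * (z.val : ZMod (5 ^ (K + 2)))) with hRdef
  have hmem : ∀ AB : ℤ × ℤ,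
      (((AB.1 : ZMod (5 ^ (K + 2))), (AB.2 : ZMod (5 ^ (K + 2)))) ∈ R) ↔
        ((AB.1 : ZMod 5) = 2 ∧ (5 : ℤ) ^ (K + 1) ∣ 4 * AB.1 ^ 3 + 27 * AB.2 ^ 2) := by
    intro AB
    rw [hRdef, Finset.mem_filter, castHom_intCast]
    simp only [Finset.mem_univ, true_and, hZ0, Finset.mem_filter]
    rw [show (4 * (AB.1 : ZMod (5 ^ (K + 2))) ^ 3 + 27 * (AB.2 : ZMod (5 ^ (K + 2))) ^ 2) =
        ((4 * AB.1 ^ 3 + 27 * AB.2 ^ 2 : ℤ) : ZMod (5 ^ (K + 2))) by push_cast; ring]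
    rw [show (∃ z, (ZMod.castHom five_dvd_twentyfive (ZMod 5)) z = 0 ∧
        ((4 * AB.1 ^ 3 + 27 * AB.2 ^ 2 : ℤ) : ZMod (5 ^ (K + 2))) =
          (5 : ZMod (5 ^ (K + 2))) ^ K * (z.val : ZMod (5 ^ (K + 2)))) ↔ _ from
      exists_zero_residue_iff (4 * AB.1 ^ 3 + 27 * AB.2 ^ 2)]
  have hR : ∀ AB : ℤ × ℤ, ((AB.1 : ZMod (5 ^ (K + 2))), (AB.2 : ZMod (5 ^ (K + 2)))) ∈ R →
      ¬ ((5 : ℕ) : ℤ) ∣ AB.1 := by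
    intro AB h h5
    have h2 := ((hmem AB).mp h).1
    have h0 := (ZMod.intCast_zmod_eq_zero_iff_dvd AB.1 5).mpr h5
    rw [h0] at h2
    exact absurd h2 (by decide)
  have hcard : R.card = 5 ^ (K + 1) * (2 * 5) := by
    rw [hRdef, card_pairs K hK Z0, hZ0, card_nonunits_mod_twentyfive]
  have h := hasHeightDensity_residues (by norm_num : (5 : ℕ).Prime) (K + 2) R hR
  have hfun : (fun AB : ℤ × ℤ ↦ ((AB.1 : ZMod (5 ^ (K + 2))), (AB.2 : ZMod (5 ^ (K + 2)))) ∈ R) =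
      (fun AB : ℤ × ℤ ↦ (AB.1 : ZMod 5) = 2 ∧ (5 : ℤ) ^ (K + 1) ∣ 4 * AB.1 ^ 3 + 27 * AB.2 ^ 2) :=
    funext fun AB ↦ propext (hmem AB)
  rw [hfun, hcard] at h
  push_cast at h ⊢
  exact h

end BSZSigmaNs

end Literature.NumberTheory.EllipticCurves


namespace Literature.NumberTheory.EllipticCurves

open BSZSigmaNs

/-! ### `ord₅` via `padicValInt` -/

/-- `ord₅ D = k` from `5^k ∣ D`, `5^{k+1} ∤ D`. [folklore] -/
theorem padicValInt_eq_of_dvd_of_not_dvd {k : ℕ} {D : ℤ} (h1 : (5 : ℤ) ^ k ∣ D)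
    (h2 : ¬ (5 : ℤ) ^ (k + 1) ∣ D) : padicValInt 5 D = k := by
  haveI : Fact (Nat.Prime 5) := ⟨Nat.prime_five⟩
  have hD : D ≠ 0 := fun h ↦ h2 (h ▸ dvd_zero _)
  have h1' := (padicValInt_dvd_iff (p := 5) k D).mp (by exact_mod_cast h1)
  have h2' : ¬ (D = 0 ∨ k + 1 ≤ padicValInt 5 D) := fun h ↦
    h2 (by exact_mod_cast (padicValInt_dvd_iff (p := 5) (k + 1) D).mpr h)
  omega

/-- `5^v ∣ D` and `5^{v+1} ∤ D` for `v = ord₅ D`, `D ≠ 0`. [folklore] -/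
theorem dvd_and_not_dvd_padicValInt {D : ℤ} (hD : D ≠ 0) :
    (5 : ℤ) ^ padicValInt 5 D ∣ D ∧ ¬ (5 : ℤ) ^ (padicValInt 5 D + 1) ∣ D := by
  haveI : Fact (Nat.Prime 5) := ⟨Nat.prime_five⟩
  refine ⟨by exact_mod_cast padicValInt_dvd (p := 5) D, fun h ↦ ?_⟩
  have h' := (padicValInt_dvd_iff (p := 5) (padicValInt 5 D + 1) D).mp (by exact_mod_cast h)
  omega

/-- `ord₅ Δ(A,B) = ord₅ (4A³ + 27B²)` (`Δ = -16(4A³+27B²)`, `5 ∤ 16`). [folklore] -/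
theorem padicValInt_disc_eq (D : ℤ) : padicValInt 5 (-16 * D) = padicValInt 5 D := by
  haveI : Fact (Nat.Prime 5) := ⟨Nat.prime_five⟩
  by_cases hD : D = 0
  · simp [hD]
  rw [padicValInt.mul (by norm_num) hD, padicValInt.eq_zero_of_not_dvd (by norm_num), zero_add]

/-! ### The density of `Σ₅^ns` -/

/-- **Bhargava–Skinner–Zhang, proof of Lemma 18: `μ₅(Σ₅^ns) = 2/25 (1 - 4/(5⁵-1)) (1 - 5⁻¹⁰)⁻¹`.**
`Σ₅^ns` "is the set of those `(A,B) ∈ ℤ₅²` with `A ≡ 2 (mod 5)` and `B ≡ ±2 (mod 5)` (so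
`5 ∣ Δ(A,B)`) and `5 ∤ ord₅(Δ(A,B))`", and "`μ₅(Σ₅^ns) = (1-5⁻¹⁰)⁻¹ Σ_{k≥1, 5∤k} 2(5-1)/5^{k+2} =
2/25 (1 - 4/(5⁵-1)) (1-5⁻¹⁰)⁻¹`". Here as a height density over the family (the tree's
`HasHeightDensity`; `ord₅ Δ(A,B) = ord₅(4A³+27B²)`, `padicValInt_disc_eq`; residues `B ≡ ±2` as
`(B : ZMod 5) ∈ {2, 3}`). Proof as printed: `{A ≡ 2, ord₅ = k}` has density `2(5-1)/5^{k+2}·(1-5⁻¹⁰)⁻¹`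
(`BSZSigmaNs.hasHeightDensity_ord_eq`, from the disc bijection of `LeadingTermBSZResidueCountProofs`
and the one-prime local density formula of `LeadingTermBSZLocalDensityProofs`); the sets with
`ord₅ ≥ K + 2` have density `→ 0` (`hasHeightDensity_ord_ge`), and the geometric series is summed in
`hasSum_fifth_powers_not_mult_five`. (That these `(A,B)` are the family members with non-split
multiplicative reduction at `5` is `hasMultiplicative_not_split_five_shortWeierstrass_iff` of
`LeadingTermBSZSplitReductionProofs`.) [cite: BhargavaSkinnerZhang2014, Lemma 18 (proof)] -/
theorem hasHeightDensity_sigma_ns_five :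
    HasHeightDensity (fun AB : ℤ × ℤ ↦ (AB.1 : ZMod 5) = 2 ∧ ((AB.2 : ZMod 5) = 2 ∨ (AB.2 : ZMod 5) = 3) ∧
        ¬ 5 ∣ padicValInt 5 (4 * AB.1 ^ 3 + 27 * AB.2 ^ 2))
      (2 / 25 * (1 - 4 / (5 ^ 5 - 1)) / (1 - 1 / (5 : ℝ) ^ 10)) := by
  -- the pieces
  set D : ℤ × ℤ → ℤ := fun AB ↦ 4 * AB.1 ^ 3 + 27 * AB.2 ^ 2 with hD
  set E : ℕ → ℤ × ℤ → Prop := fun k AB ↦ (AB.1 : ZMod 5) = 2 ∧ (5 : ℤ) ^ k ∣ D AB ∧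
      ¬ (5 : ℤ) ^ (k + 1) ∣ D AB with hE
  set S : ℕ → Finset ℕ := fun K ↦ (Finset.range (K + 1 + 1)).filter (fun k ↦ 1 ≤ k ∧ ¬ 5 ∣ k)
    with hS
  set L : ℕ → ℤ × ℤ → Prop := fun K AB ↦ ∃ k ∈ S K, E k AB with hL
  set F : ℕ → ℤ × ℤ → Prop := fun K AB ↦ (AB.1 : ZMod 5) = 2 ∧ (5 : ℤ) ^ (K + 1 + 1) ∣ D AB with hF
  set U : ℕ → ℤ × ℤ → Prop := fun K AB ↦ L K AB ∨ F K AB with hU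
  set c : ℝ := 1 - 1 / (5 : ℝ) ^ 10 with hc
  set e : ℕ → ℝ := fun k ↦ ((5 ^ (k + 1) * (2 * 20) : ℕ) : ℝ) / ((5 : ℝ) ^ (k + 2)) ^ 2 / c with he
  set f : ℕ → ℝ := fun K ↦ ((5 ^ (K + 1 + 1) * (2 * 5) : ℕ) : ℝ) / ((5 : ℝ) ^ (K + 1 + 2)) ^ 2 / c
    with hf
  set ℓ : ℕ → ℝ := fun K ↦ ∑ k ∈ S K, e k with hℓ
  have hc0 : c ≠ 0 := by rw [hc]; norm_num
  -- disjointness of the `E k`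
  have hEdisj : ∀ i j : ℕ, i ≠ j → ∀ AB : ℤ × ℤ, E i AB → ¬ E j AB := by
    intro i j hij AB ⟨_, hi1, hi2⟩ ⟨_, hj1, hj2⟩
    rcases Nat.lt_or_gt_of_ne hij with h | h
    · exact hi2 ((pow_dvd_pow (5 : ℤ) (Nat.succ_le_of_lt h)).trans hj1)
    · exact hj2 ((pow_dvd_pow (5 : ℤ) (Nat.succ_le_of_lt h)).trans hi1)
  -- densities of `L K` and `U K`
  have hLd : ∀ K, HasHeightDensity (L K) (ℓ K) := fun K ↦
    HasHeightDensity.finset_biSup (S K) E e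
      (fun k hk ↦ by
        have hk1 : 1 ≤ k := ((Finset.mem_filter.mp hk).2).1
        exact hasHeightDensity_ord_eq hk1)
      (fun i _ j _ hij AB _ ↦ hEdisj i j hij AB)
  have hUd : ∀ K, HasHeightDensity (U K) (ℓ K + f K) := fun K ↦
    (hLd K).or_of_disjoint (hasHeightDensity_ord_ge (K := K + 1) (by omega)) (by
      rintro AB - ⟨k, hk, -, -, hk2⟩ ⟨-, hF2⟩
      have hkK : k + 1 ≤ K + 1 + 1 := by
        have := Finset.mem_range.mp (Finset.mem_filter.mp hk).1
        omega
      exact hk2 ((pow_dvd_pow (5 : ℤ) hkK).trans hF2))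
  -- residues: `A ≡ 2`, then `5 ∣ D ↔ B ≡ ±2`
  have hres : ∀ AB : ℤ × ℤ, (AB.1 : ZMod 5) = 2 →
      ((5 : ℤ) ∣ D AB ↔ ((AB.2 : ZMod 5) = 2 ∨ (AB.2 : ZMod 5) = 3)) := by
    intro AB hA
    rw [← zmod5_disc_two, ← hA]
    have : (4 * (AB.1 : ZMod 5) ^ 3 + 27 * (AB.2 : ZMod 5) ^ 2) = ((D AB : ℤ) : ZMod 5) := by
      rw [hD]; push_cast; ring
    rw [this, ZMod.intCast_zmod_eq_zero_iff_dvd]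
    push_cast
    rfl
  refine hasHeightDensity_of_squeeze L U ℓ (fun K ↦ ℓ K + f K) hLd hUd ?_ ?_ ?_ ?_
  · -- `L K ⊆ Σ₅^ns`
    rintro K AB - ⟨k, hk, hA, hk1, hk2⟩
    have hk' := (Finset.mem_filter.mp hk).2
    refine ⟨hA, (hres AB hA).mp ((dvd_pow_self (5 : ℤ) (by omega)).trans hk1), ?_⟩
    rw [show (4 * AB.1 ^ 3 + 27 * AB.2 ^ 2 : ℤ) = D AB from rfl,
      padicValInt_eq_of_dvd_of_not_dvd hk1 hk2]
    exact hk'.2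
  · -- `Σ₅^ns ⊆ U K`
    rintro K AB hfam ⟨hA, hB, hv⟩
    have hD0 : D AB ≠ 0 := hfam.1
    rw [show (4 * AB.1 ^ 3 + 27 * AB.2 ^ 2 : ℤ) = D AB from rfl] at hv
    have h5D : (5 : ℤ) ∣ D AB := (hres AB hA).mpr hB
    obtain ⟨hv1, hv2⟩ := dvd_and_not_dvd_padicValInt hD0
    have hv0 : 1 ≤ padicValInt 5 (D AB) := by
      by_contra h
      have h0 : padicValInt 5 (D AB) = 0 := by omega
      rw [h0, zero_add, pow_one] at hv2
      exact hv2 h5D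
    by_cases hvK : padicValInt 5 (D AB) ≤ K + 1
    · left
      exact ⟨padicValInt 5 (D AB),
        Finset.mem_filter.mpr ⟨Finset.mem_range.mpr (by omega), hv0, hv⟩, hA, hv1, hv2⟩
    · right
      exact ⟨hA, (pow_dvd_pow (5 : ℤ) (by omega)).trans hv1⟩
  · -- `ℓ K → μ`
    have hek : ∀ k, e k = 8 / 25 / c * (1 / 5 : ℝ) ^ k := by
      intro k
      rw [he, one_div_pow]
      push_cast
      field_simp
      ring
    have h := (tendsto_partial_sums_not_mult_five (8 / 25 / c)).comp (tendsto_add_atTop_nat 1)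
    have hμ : 8 / 25 / c * (1 / 4 - 1 / (5 ^ 5 - 1)) = 2 / 25 * (1 - 4 / (5 ^ 5 - 1)) / c := by
      field_simp
      ring
    rw [← hμ]
    refine h.congr fun K ↦ ?_
    simp only [Function.comp_apply, hℓ, hek, hS]
  · -- `ℓ K + f K → μ`
    have hek : ∀ k, e k = 8 / 25 / c * (1 / 5 : ℝ) ^ k := by
      intro k
      rw [he, one_div_pow]
      push_cast
      field_simp
      ring
    have h := (tendsto_partial_sums_not_mult_five (8 / 25 / c)).comp (tendsto_add_atTop_nat 1)
    have hμ : 8 / 25 / c * (1 / 4 - 1 / (5 ^ 5 - 1)) = 2 / 25 * (1 - 4 / (5 ^ 5 - 1)) / c := by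
      field_simp
      ring
    have hℓ' : Tendsto ℓ atTop (𝓝 (2 / 25 * (1 - 4 / (5 ^ 5 - 1)) / c)) := by
      rw [← hμ]
      refine h.congr fun K ↦ ?_
      simp only [Function.comp_apply, hℓ, hek, hS]
    have hfK : ∀ K, f K = 2 / 125 / c * (1 / 5 : ℝ) ^ K := by
      intro K
      rw [hf, one_div_pow]
      push_cast
      field_simp
      ring
    have hf0 : Tendsto f atTop (𝓝 0) := by
      rw [show f = fun K ↦ 2 / 125 / c * (1 / 5 : ℝ) ^ K from funext hfK]
      rw [show (0 : ℝ) = 2 / 125 / c * 0 by ring]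
      exact (tendsto_pow_atTop_nhds_zero_of_lt_one (by norm_num) (by norm_num)).const_mul _
    have := hℓ'.add hf0
    rwa [add_zero] at this

end Literature.NumberTheory.EllipticCurves
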